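import Mathlib
import Summits.Parity.BatemanHorn.Theses.PolynomialMobius
import Literature.NumberTheory.Sieve.BatemanHornProofs
import HarnessLib

/-!
# Crux `PolyMobiusTail` (stmt-Parity-0870), line `eta-free-multilinear-window`, stub
# `stub_pair_balanced` — helper 1: the linear pair, the swap of summations and the count

Lead `prover-line-stmt-Parity-0870-c3-0`, stub-worker W3.  For a Bateman–Horn PAIR `f = (f₀, f₁)` of
degree `≤ 1` every member is `fᵢ = qᵢ X + aᵢ` with `qᵢ ≥ 1`, `gcd(qᵢ, aᵢ) = 1` (no fixed prime
divisor) and `Δ = q₁ a₀ − q₀ a₁ ≠ 0` (non-association).  The window sums of the line have the shape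
`Σ_{1 ≤ n ≤ x} Σ_{dᵢ ∣ fᵢ(n)⁺} G(d)`; this file proves the exact SWAP

  `Σ_{n ≤ x} Σ_{d ∣ f(n)⁺} G(d) = Σ_{d ∈ Box(x)} G(d) · A(d; x)`,
  `A(d; x) = #{n₀ < n ≤ x : d₀ ∣ q₀n + a₀, d₁ ∣ q₁n + a₁}`        (`stub_pairSwapCount`),

where `Box(x) = [1, f₀(x)⁺] × [1, f₁(x)⁺]` and `n₀ = max_i ⌊(−aᵢ)⁺/qᵢ⌋` is the last `n ≥ 1` at which
some `fᵢ(n) ≤ 0` (`pos_iff_threshold_lt`; the divisor sets of non-positive values are empty because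
of `Int.toNat`).  The count `A(d; x)` is then, by the Literature file `LinearCongruencePairs.lean`
(`card_Ioc_filter_pair_eq_saw`), `(x − n₀)/lcm(d₀,d₁) + ψ((n₀ − ν)/lcm) − ψ((x − ν)/lcm)` on the
solvable pairs (`gcd(d₀,q₀) = gcd(d₁,q₁) = 1`, `gcd(d₀,d₁) ∣ Δ`) and `0` otherwise, with the phase
`ν/lcm` a Kloosterman fraction (`exists_sol_eq_kloostermanFraction`) — the entry point of the
Duke–Friedlander–Iwaniec bound in the balanced range.

Contents: `natDegree_eq_one`, `eval_eq`, `leadingCoeff_toNat`, `isCoprime_leadingCoeff_coeff_zero`,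
`resultant_ne_zero`, `eval_pos_iff`, `pos_iff_threshold_lt`, `mem_piFinset_divisors_iff`,
`stub_pairSwapCount`.  Everything is proved; imports `Mathlib`, the Theses file (for
`IsBatemanHornSystem`) and `Literature.NumberTheory.Sieve.BatemanHornProofs` (`natDegree_pos`).
-/

open scoped BigOperators
open Filter Finset Polynomial Asymptotics

namespace Summit.Parity.BatemanHorn.Theorems.PolyMobiusTail.EtaFreeWindow

open Literature.NumberTheory.Sieve

namespace PairLinear

variable {f : Fin 2 → ℤ[X]}

/-! ### The shape of a degree-`≤ 1` Bateman–Horn pair -/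

/-- In a Bateman–Horn system of degree `≤ 1` every member has degree exactly `1` (constants are
excluded by `IsBatemanHornSystem.natDegree_pos`). [folklore] -/
theorem natDegree_eq_one (hf : IsBatemanHornSystem f) (hlin : ∀ i, (f i).natDegree ≤ 1)
    (i : Fin 2) : (f i).natDegree = 1 :=
  le_antisymm (hlin i) (hf.natDegree_pos i)

/-- A degree-one polynomial evaluates as `q·n + a` with `q` its leading coefficient and `a` its
constant term. [folklore] -/
theorem eval_eq {i : Fin 2} (hdeg : (f i).natDegree = 1) (n : ℤ) :
    (f i).eval n = (f i).leadingCoeff * n + (f i).coeff 0 := by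
  have h := eq_X_add_C_of_natDegree_le_one (p := f i) hdeg.le
  have hlc : (f i).leadingCoeff = (f i).coeff 1 := by rw [leadingCoeff, hdeg]
  conv_lhs => rw [h]
  rw [eval_add, eval_mul, eval_C, eval_X, eval_C, hlc]

/-- The leading coefficient, as a natural number, is positive and casts back. [folklore] -/
theorem leadingCoeff_toNat (hf : IsBatemanHornSystem f) (i : Fin 2) :
    0 < (f i).leadingCoeff.toNat ∧ (((f i).leadingCoeff.toNat : ℕ) : ℤ) = (f i).leadingCoeff := by
  have hq : 0 < (f i).leadingCoeff := hf.leadingCoeff_pos i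
  exact ⟨by omega, Int.toNat_of_nonneg hq.le⟩

/-- No fixed prime divisor forces `gcd(qᵢ, aᵢ) = 1`: a prime dividing both `qᵢ` and `aᵢ` divides
`fᵢ(n)` for every `n`, hence `∏ⱼ fⱼ(n)` for every `n`. [folklore] -/
theorem isCoprime_leadingCoeff_coeff_zero (hf : IsBatemanHornSystem f) {i : Fin 2}
    (hdeg : (f i).natDegree = 1) : IsCoprime (f i).leadingCoeff ((f i).coeff 0) := by
  rw [Int.isCoprime_iff_gcd_eq_one]
  by_contra hne
  obtain ⟨p, hp, hpdvd⟩ := Nat.exists_prime_and_dvd hne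
  have hpq : (p : ℤ) ∣ (f i).leadingCoeff :=
    (Int.natCast_dvd_natCast.2 hpdvd).trans (Int.gcd_dvd_left _ _)
  have hpa : (p : ℤ) ∣ (f i).coeff 0 :=
    (Int.natCast_dvd_natCast.2 hpdvd).trans (Int.gcd_dvd_right _ _)
  have hlt := hf.hasNoFixedPrimeDivisor p hp
  unfold polyRootCountMod at hlt
  have hall : ((range p).filter fun n : ℕ => (p : ℤ) ∣ ∏ j, (f j).eval (n : ℤ)) = range p := by
    refine Finset.filter_true_of_mem fun n _ => ?_
    refine Dvd.dvd.trans ?_ (Finset.dvd_prod_of_mem (fun j => (f j).eval (n : ℤ)) (mem_univ i))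
    rw [eval_eq hdeg]
    exact (hpq.mul_right _).add hpa
  rw [hall, card_range] at hlt
  exact lt_irrefl _ hlt

/-- The resultant `Δ = q₁ a₀ − q₀ a₁` of a Bateman–Horn pair of degree one is non-zero: otherwise
`q₁ f₀ = q₀ f₁`, and two primitive degree-one polynomials with positive leading coefficients that
are proportional are equal, contradicting non-association. [folklore] -/
theorem resultant_ne_zero (hf : IsBatemanHornSystem f) (hdeg : ∀ i, (f i).natDegree = 1) :
    (f 1).leadingCoeff * (f 0).coeff 0 - (f 0).leadingCoeff * (f 1).coeff 0 ≠ 0 := by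
  intro hΔ
  set q₀ := (f 0).leadingCoeff with hq₀
  set a₀ := (f 0).coeff 0 with ha₀
  set q₁ := (f 1).leadingCoeff with hq₁
  set a₁ := (f 1).coeff 0 with ha₁
  have hq₀pos : 0 < q₀ := hf.leadingCoeff_pos 0
  have hq₁pos : 0 < q₁ := hf.leadingCoeff_pos 1
  have hc₀ : IsCoprime q₀ a₀ := isCoprime_leadingCoeff_coeff_zero hf (hdeg 0)
  have hc₁ : IsCoprime q₁ a₁ := isCoprime_leadingCoeff_coeff_zero hf (hdeg 1)
  -- `q₀ ∣ q₁ a₀` and `gcd(q₀, a₀) = 1` give `q₀ ∣ q₁`; symmetrically `q₁ ∣ q₀`; so `q₀ = q₁`.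
  have h01 : q₀ ∣ q₁ := by
    have : q₀ ∣ q₁ * a₀ := ⟨a₁, by linear_combination hΔ⟩
    exact hc₀.dvd_of_dvd_mul_right this
  have h10 : q₁ ∣ q₀ := by
    have : q₁ ∣ q₀ * a₁ := ⟨a₀, by linear_combination -hΔ⟩
    exact hc₁.dvd_of_dvd_mul_right this
  have hqq : q₀ = q₁ := Int.dvd_antisymm hq₀pos.le hq₁pos.le h01 h10
  have haa : a₀ = a₁ := by
    have : q₁ * (a₀ - a₁) = 0 := by linear_combination hΔ + a₁ * hqq
    rcases mul_eq_zero.1 this with h | h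
    · exact absurd h hq₁pos.ne'
    · linarith
  have hfeq : f 0 = f 1 := by
    have h0 := eq_X_add_C_of_natDegree_le_one (p := f 0) (hdeg 0).le
    have h1 := eq_X_add_C_of_natDegree_le_one (p := f 1) (hdeg 1).le
    have hl0 : (f 0).coeff 1 = q₀ := by rw [hq₀, leadingCoeff, hdeg 0]
    have hl1 : (f 1).coeff 1 = q₁ := by rw [hq₁, leadingCoeff, hdeg 1]
    rw [h0, h1, hl0, hl1, hqq, ← ha₀, ← ha₁, haa]
  exact hf.pairwise_not_associated (show (0 : Fin 2) ≠ 1 by decide) (hfeq ▸ Associated.refl _)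

/-! ### Positivity of the values and the threshold `n₀` -/

/-- For `q ≥ 1`, `a ∈ ℤ` and a natural `n ≥ 1`: `q n + a > 0 ↔ ⌊(−a)⁺/q⌋ < n`. [folklore] -/
theorem linear_pos_iff {q a : ℤ} (hq : 0 < q) {n : ℕ} (hn : 1 ≤ n) :
    0 < q * n + a ↔ (-a).toNat / q.toNat < n := by
  have hqN : (q.toNat : ℤ) = q := Int.toNat_of_nonneg hq.le
  have hq' : 0 < q.toNat := by omega
  rcases le_or_gt 0 a with ha | ha
  · -- `a ≥ 0`: both sides hold
    have h1 : (-a).toNat = 0 := Int.toNat_eq_zero.2 (by linarith)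
    rw [h1, Nat.zero_div]
    constructor
    · intro _; omega
    · intro _
      have : (0 : ℤ) < q * n := mul_pos hq (by exact_mod_cast hn)
      linarith
  · -- `a < 0`: `q n > |a| ↔ n > |a| / q`
    have h1 : ((-a).toNat : ℤ) = -a := Int.toNat_of_nonneg (by linarith)
    rw [Nat.div_lt_iff_lt_mul hq']
    constructor
    · intro h
      have : ((-a).toNat : ℤ) < (n : ℤ) * q.toNat := by rw [h1, hqN]; linarith
      exact_mod_cast this
    · intro h
      have : ((-a).toNat : ℤ) < (n : ℤ) * q.toNat := by exact_mod_cast h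
      rw [h1, hqN] at this
      linarith

/-- `fᵢ(n) > 0 ↔ ⌊(−aᵢ)⁺/qᵢ⌋ < n` for a degree-one member and `n ≥ 1`. [folklore] -/
theorem eval_pos_iff (hf : IsBatemanHornSystem f) {i : Fin 2} (hdeg : (f i).natDegree = 1)
    {n : ℕ} (hn : 1 ≤ n) :
    0 < (f i).eval (n : ℤ) ↔ (-(f i).coeff 0).toNat / (f i).leadingCoeff.toNat < n := by
  rw [eval_eq hdeg]
  exact linear_pos_iff (hf.leadingCoeff_pos i) hn

/-- **The threshold.**  With `n₀ = max(⌊(−a₀)⁺/q₀⌋, ⌊(−a₁)⁺/q₁⌋)`, for `n ≥ 1` all values `fᵢ(n)`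
are positive iff `n₀ < n`. [folklore] -/
theorem pos_iff_threshold_lt (hf : IsBatemanHornSystem f) (hdeg : ∀ i, (f i).natDegree = 1)
    {n : ℕ} (hn : 1 ≤ n) :
    (∀ i, 0 < (f i).eval (n : ℤ)) ↔
      max ((-(f 0).coeff 0).toNat / (f 0).leadingCoeff.toNat)
        ((-(f 1).coeff 0).toNat / (f 1).leadingCoeff.toNat) < n := by
  rw [max_lt_iff, ← eval_pos_iff hf (hdeg 0) hn, ← eval_pos_iff hf (hdeg 1) hn]
  constructor
  · intro h; exact ⟨h 0, h 1⟩
  · rintro ⟨h0, h1⟩ i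
    fin_cases i
    · exact h0
    · exact h1

/-! ### The swap of summations -/

/-- Membership in the product of the divisor sets of the values: for `n ≥ 1`,
`d ∈ ∏ᵢ divisors(fᵢ(n)⁺)` iff `n₀ < n` and `dᵢ ∣ fᵢ(n)` for all `i`. [folklore] -/
theorem mem_piFinset_divisors_iff (hf : IsBatemanHornSystem f) (hdeg : ∀ i, (f i).natDegree = 1)
    {n : ℕ} (hn : 1 ≤ n) (d : Fin 2 → ℕ) :
    d ∈ Fintype.piFinset (fun i => (((f i).eval (n : ℤ)).toNat).divisors) ↔
      max ((-(f 0).coeff 0).toNat / (f 0).leadingCoeff.toNat)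
          ((-(f 1).coeff 0).toNat / (f 1).leadingCoeff.toNat) < n ∧
        ∀ i, ((d i : ℕ) : ℤ) ∣ (f i).eval (n : ℤ) := by
  rw [← pos_iff_threshold_lt hf hdeg hn, Fintype.mem_piFinset]
  constructor
  · intro h
    have h' : ∀ i, 0 < (f i).eval (n : ℤ) ∧ ((d i : ℕ) : ℤ) ∣ (f i).eval (n : ℤ) := by
      intro i
      have hi := h i
      rw [Nat.mem_divisors] at hi
      obtain ⟨hdvd, hne⟩ := hi
      have hpos : 0 < (f i).eval (n : ℤ) := by
        by_contra hle
        push Not at hle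
        exact hne (Int.toNat_eq_zero.2 hle)
      refine ⟨hpos, ?_⟩
      have := Int.natCast_dvd_natCast.2 hdvd
      rwa [Int.toNat_of_nonneg hpos.le] at this
    exact ⟨fun i => (h' i).1, fun i => (h' i).2⟩
  · rintro ⟨hpos, hdvd⟩ i
    rw [Nat.mem_divisors]
    refine ⟨?_, fun h0 => ?_⟩
    · have := hdvd i
      rw [← Int.toNat_of_nonneg (hpos i).le] at this
      exact Int.natCast_dvd_natCast.1 this
    · have := Int.toNat_eq_zero.1 h0
      exact absurd (hpos i) (not_lt.2 this)

/-- Every divisor tuple that occurs for some `1 ≤ n ≤ x` lies in the box `∏ᵢ [1, fᵢ(x)⁺]` (the values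
increase with `n`). [folklore] -/
theorem piFinset_divisors_subset_box (hf : IsBatemanHornSystem f) (hdeg : ∀ i, (f i).natDegree = 1)
    {n x : ℕ} (hnx : n ≤ x) :
    Fintype.piFinset (fun i => (((f i).eval (n : ℤ)).toNat).divisors) ⊆
      Fintype.piFinset (fun i => Finset.Icc 1 (((f i).eval (x : ℤ)).toNat)) := by
  intro d hd
  rw [Fintype.mem_piFinset] at hd ⊢
  intro i
  have hi := hd i
  rw [Nat.mem_divisors] at hi
  obtain ⟨hdvd, hne⟩ := hi
  rw [Finset.mem_Icc]
  refine ⟨Nat.pos_of_ne_zero fun h0 => hne (by rw [h0] at hdvd; exact (zero_dvd_iff.1 hdvd)), ?_⟩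
  refine (Nat.le_of_dvd (Nat.pos_of_ne_zero hne) hdvd).trans ?_
  have hmono : (f i).eval (n : ℤ) ≤ (f i).eval (x : ℤ) := by
    rw [eval_eq (hdeg i), eval_eq (hdeg i)]
    have hq : 0 < (f i).leadingCoeff := hf.leadingCoeff_pos i
    have : (n : ℤ) ≤ x := by exact_mod_cast hnx
    nlinarith
  exact Int.toNat_le_toNat hmono

end PairLinear

open PairLinear in
/-- **Swap of summations and the count (aux stub `stub_pairSwapCount`, helper 1 of
`stub_pair_balanced`).**  For a Bateman–Horn pair `f = (q₀X + a₀, q₁X + a₁)` of degree `≤ 1`, any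
weight `G` on divisor pairs and every `x`,
`Σ_{1 ≤ n ≤ x} Σ_{dᵢ ∣ fᵢ(n)⁺} G(d) = Σ_{d ∈ [1,f₀(x)⁺]×[1,f₁(x)⁺]} G(d) · #{n₀ < n ≤ x : d₀ ∣ f₀(n), d₁ ∣ f₁(n)}`
with the threshold `n₀ = max(⌊(−a₀)⁺/q₀⌋, ⌊(−a₁)⁺/q₁⌋)` (for `n ≥ 1`, `fᵢ(n) > 0` for both `i` iff
`n > n₀`; non-positive values have no divisors after `Int.toNat`).  The inner count is an
arithmetic progression count modulo `lcm(d₀, d₁)` (`Literature.NumberTheory.Sieve.LinearCongruencePair`).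
[folklore] -/
theorem stub_pairSwapCount : ∀ (f : Fin 2 → ℤ[X]), IsBatemanHornSystem f →
    (∀ i, (f i).natDegree ≤ 1) → ∀ (G : (Fin 2 → ℕ) → ℝ) (x : ℕ),
    (∑ n ∈ Finset.Icc 1 x,
        ∑ d ∈ Fintype.piFinset (fun i => (((f i).eval (n : ℤ)).toNat).divisors), G d) =
      ∑ d ∈ Fintype.piFinset (fun i => Finset.Icc 1 (((f i).eval (x : ℤ)).toNat)),
        G d * ((((Finset.Ioc (max ((-(f 0).coeff 0).toNat / (f 0).leadingCoeff.toNat)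
            ((-(f 1).coeff 0).toNat / (f 1).leadingCoeff.toNat)) x).filter
              (fun n : ℕ => ∀ i, ((d i : ℕ) : ℤ) ∣ (f i).eval (n : ℤ))).card : ℕ) : ℝ) := by
  intro f hf hlin G x
  have hdeg : ∀ i, (f i).natDegree = 1 := natDegree_eq_one hf hlin
  set n₀ : ℕ := max ((-(f 0).coeff 0).toNat / (f 0).leadingCoeff.toNat)
    ((-(f 1).coeff 0).toNat / (f 1).leadingCoeff.toNat) with hn₀
  set Box := Fintype.piFinset (fun i => Finset.Icc 1 (((f i).eval (x : ℤ)).toNat)) with hBox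
  -- rewrite each inner sum as a sum over the box with an indicator
  have hinner : ∀ n ∈ Finset.Icc 1 x,
      ∑ d ∈ Fintype.piFinset (fun i => (((f i).eval (n : ℤ)).toNat).divisors), G d =
        ∑ d ∈ Box, if n₀ < n ∧ ∀ i, ((d i : ℕ) : ℤ) ∣ (f i).eval (n : ℤ) then G d else 0 := by
    intro n hn
    rw [Finset.mem_Icc] at hn
    rw [← Finset.sum_filter]
    refine Finset.sum_congr ?_ fun _ _ => rfl
    ext d
    rw [Finset.mem_filter, mem_piFinset_divisors_iff hf hdeg hn.1]
    constructor
    · intro h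
      exact ⟨piFinset_divisors_subset_box hf hdeg hn.2
        ((mem_piFinset_divisors_iff hf hdeg hn.1 d).2 h), h⟩
    · exact fun h => h.2
  rw [Finset.sum_congr rfl hinner, Finset.sum_comm]
  refine Finset.sum_congr rfl fun d _ => ?_
  -- the two filtered sets coincide
  have hset : (Finset.Icc 1 x).filter (fun n => n₀ < n ∧ ∀ i, ((d i : ℕ) : ℤ) ∣ (f i).eval (n : ℤ)) =
      (Finset.Ioc n₀ x).filter (fun n : ℕ => ∀ i, ((d i : ℕ) : ℤ) ∣ (f i).eval (n : ℤ)) := by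
    ext n
    rw [Finset.mem_filter, Finset.mem_filter, Finset.mem_Icc, Finset.mem_Ioc]
    constructor
    · rintro ⟨⟨-, hnx⟩, hn₀', hdvd⟩
      exact ⟨⟨hn₀', hnx⟩, hdvd⟩
    · rintro ⟨⟨hn₀', hnx⟩, hdvd⟩
      exact ⟨⟨Nat.one_le_of_lt hn₀', hnx⟩, hn₀', hdvd⟩
  rw [← Finset.sum_filter, hset, Finset.sum_const, nsmul_eq_mul, mul_comm]

end Summit.Parity.BatemanHorn.Theorems.PolyMobiusTail.EtaFreeWindow
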